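import Summits.BirchSwinnertonDyer.BirchSwinnertonDyer.Theorems.SemiOrdinaryEisensteinDescentShaTwoCochainBridgeSum
import Summits.BirchSwinnertonDyer.BirchSwinnertonDyer.Theorems.SemiOrdinaryEisensteinDescentShaTwoCochainReadoutVanishing
import Summits.BirchSwinnertonDyer.BirchSwinnertonDyer.Theorems.SemiOrdinaryEisensteinDescentCasselsTateLevelInputsOfPoitouTateAt
import Literature.NumberTheory.GaloisRepresentations.ContinuousH2OrderTwo
import HarnessLib

/-!
# The Ш²-cochain bridge, FINAL ASSEMBLY modulo S3 in its WEAKEST, SIGN-FREE form: the shell's binder ⟸ «for idèle `2`-cocycles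
# `Z` with class image `h ∘ c`, vanishing archimedean local classes and VANISHING finite-place invariant sums, the road-B readout
# `classBarInv(Φ⁻¹[γ] ∘ ∂h)` vanishes»

Route `SemiOrdinaryEisensteinDescent` (BSD, rung W-ALL row 2·3@3), Kolyvagin column, Cassels–Tate lane: print item
`CasselsTateLevelInputsFact` (stmt-BirchSwinnertonDyer-20191).  Sequel / CORRECTION of `…ShaTwoCochainBridgeAssembly` (p643550): its displayed
binder `hS3` quantified over ALL idèle `2`-cocycles `Z` with `jC ∘ Z = h ∘ c` and is FALSE at fields with a real place (width seat w5 g6,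
cell bus 15:11Z: twist `Z` by a Brauer class with invariant `½` at a real place and `½` at one finite place — `jC` kills `K̄ˣ`, the
finite-place sum moves by `½`, the right-hand side does not).  The finite-place sum equals the global invariant only when the
ARCHIMEDEAN local classes of `Z` vanish (`IdeleCohomology.inv_eq_sum_place_of_forall_localInvInf_eq_zero`).  For the bridge's `Z` they
do: every local class of `Z` is `m²`-torsion (conjunct (c) of w3 g7's `ShaTwoCochain.exists_bridge_sum_localInvariants_eq_zero`,
p642488) and `m² = p^{2M₀}` is odd, while `H²(K_w, ·)` is killed by `2` at an infinite place
(`eq_zero_of_odd_nsmul_eq_zero_two_infinitePlace`).  So: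

* **`hbridge_of_readout_criterion`** — the binder `hbridge` of `ShaTwoCochainTheta.casselsTate_levelInputs_of_readout_vanishing_flip`
  (p639762) ⟸ the SIGN-FREE CRITERION `hS3c`: for `(ρ₀, h, γ, c, h̃, Z)` with (3)(4)(5), every archimedean local projection class of `Z`
  vanishing, and the finite-place invariant sums `Σ_{v ∈ T} inv_{K_v}[π_v Z|_v]` vanishing for all large `T`, the readout
  `classBarInv(Φ⁻¹[γ] ∘ ∂h)` vanishes.  This is implied by the global-invariant-sum identity of S3 with EITHER sign convention
  (companion of `hbridge_of_globalInvariantSum_arch`, p644224, which displays the identity with a `+` sign).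
  Proof: `γ ∈ y`; w3 g7's `exists_bridge_sum_localInvariants_eq_zero` (inputs: `hPTc`'s hypothesis, `Ψ h = θ′_* [f]`, `γ` locally
  trivial, `H³(K, μ) = 0` at odd prime-power level — `galoisCohomology_three_mu_eq_zero_of_ne_two`; THE idèle projections) gives
  `Z, c, h̃` with (3)(4)(5), the vanishing of the finite-place sums over large `T` (b), and the `m²`-torsion of all local classes (c);
  the archimedean classes vanish by oddness; `hS3'` reads the finite-place sum as `classBarInv(Φ⁻¹[γ] ∘ ∂h)`.

Hence `casselsTate_levelInputs K` for THE maps is `casselsTate_levelInputs_of_readout_vanishing_flip K (hbridge_of_readout_criterion K hS3c)`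
once `hS3c` is a theorem (w3 g8 `…ClassReadout`, w2 g11 `…ClassInvariant`/`…LayerTriangle`, w5 g6 `…ClassInflation`).  THEOREMS ONLY;
a reduction with ONE displayed hypothesis on existing objects; no case of BSD, Poitou–Tate or Cassels–Tate is proved here.  Width seat
`bsd-wall-soed-p2-w4` g2 (glue owner); `--supports stmt-BirchSwinnertonDyer-20480`, helper; route-free.

## References
* [MilneADT2006] J. S. Milne, *Arithmetic Duality Theorems*, 2nd ed. (2006), Ch. I Thm. 4.10 (a) (proof, pp. 57–58), Lemma 4.13,
  Rem. 3.7 (`2` kills `H^r(ℝ, ·)`), §6 Thm. 6.13 (a).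
* [CasselsFrohlichANT1967] J. W. S. Cassels, A. Fröhlich (eds.), *Algebraic Number Theory* (1967), Ch. VII §9.6, §10, §11.2 (bis).
* [SerreGaloisCohomology1997] J.-P. Serre, *Galois Cohomology* (1997), I §2.4, II §4.4 Prop. 13.
-/

noncomputable section

open scoped Classical
open Function NumberField IsDedekindDomain CategoryTheory CategoryTheory.Abelian
open scoped NumberField ContRepresentation

-- `Summit.<P>.<Sub>` repeats `BirchSwinnertonDyer` by the tree's layout convention (D-0017)
set_option linter.dupNamespace false
set_option autoImplicit false

namespace Summit.BirchSwinnertonDyer.BirchSwinnertonDyer.Theorems.ShaTwoCochainTheta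

open _root_.WeierstrassCurve Field
open Literature.NumberTheory.EllipticCurves
open Literature.NumberTheory.GaloisRepresentations Literature.NumberTheory.GaloisCohomology
open Literature.NumberTheory.GaloisRepresentations.DiscreteGaloisModule (mu MuCarrier units UnitsCarrier pairing TateDual tateDual
  tateDualPairing pairingDualHom pairingDualIntertwining sha shaTwo)
open Literature.Algebra.Homology Literature.Algebra.Homology.DiscreteRep Literature.Algebra.Homology.ExtPresentation
open Literature.NumberTheory.GaloisRepresentations.IdeleClassBar (classBarD classBarInv)
open Literature.NumberTheory.GaloisRepresentations.HomDual
open Literature.NumberTheory.GaloisRepresentations.FreePresentation (presentationComplex presentationComplex_shortExact presModule₁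
  pres_isSES moduleFinite_presModule₁)
open Literature.NumberTheory.GaloisRepresentations.DGMBridge
open Literature.NumberTheory.GaloisRepresentations.OpenLayer (extOneEquiv)
open Literature.AnabelianGeometry.AbsoluteAnabelian (Prop121vii.brauerInvariantEquiv Prop121vii.zmodToQmodZ)
open Summit.BirchSwinnertonDyer.BirchSwinnertonDyer.Theorems.ShaTwoCochain
open Summit.BirchSwinnertonDyer.BirchSwinnertonDyer.Theorems.CasselsTateLemma615OfPT (galoisCohomology_three_mu_eq_zero_of_ne_two)

variable (K : Type) [Field K] [NumberField K]

/-- **The shell's binder from the SIGN-FREE readout criterion `hS3c`** — see the module docstring.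
[cite: MilneADT2006, Ch. I Thm. 4.10 (a) (proof, pp. 57–58), Lemma 4.13, Rem. 3.7][cite: CasselsFrohlichANT1967, Ch. VII §11.2 (bis)] -/
theorem hbridge_of_readout_criterion
    (hS3c : ∀ (n : ℕ) [NeZero n] {M : Type} [AddCommGroup M] [TopologicalSpace M] [DiscreteTopology M] [Finite M]
      (ρ₀ : DiscreteGaloisModule K M) (hM : ∀ m : M, n • m = 0)
      (h : (presentationComplex ρ₀).X₁ ⟶ classBarD K) (γ : contOneCocycles ρ₀.toTopRep)
      (c : contTwoCocycles (presModule₁ ρ₀).toTopRep)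
      (ht : DiscreteRep.HomCarrier (LCarrier (presentationComplex ρ₀).X₁) (LCarrier (ideleBarD K)))
      (Z : contTwoCocycles (toDGM (ideleBarD K)).toTopRep),
      haveI := moduleFinite_presModule₁ ρ₀
      haveI := absoluteGaloisGroup_compactSpace K
      (∀ x : LCarrier (presentationComplex ρ₀).X₁,
        ideleToClassI K ((show _ →ₗ[ℤ] LCarrier (ideleBarD K) from ht) x) = lmap (presentationComplex ρ₀).X₁ (classBarD K) h x) →
      (pres_isSES ρ₀).δ₁ (oneCocycleClass _ γ) = twoCocycleClass _ c →
      (∀ σ τ : absoluteGaloisGroup K,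
        ideleToClassI K (Z.1 (σ, τ)) = lmap (presentationComplex ρ₀).X₁ (classBarD K) h (c.1 (σ, τ))) →
      ∀ (cZ : (v : HeightOneSpectrum (𝓞 K)) → contTwoCocycles (units (v.adicCompletion K)).toTopRep),
        (∀ (v : HeightOneSpectrum (𝓞 K)) (s t : absoluteGaloisGroup (v.adicCompletion K)),
          (cZ v).1 (s, t) = ((IdeleReadout.ideleProjection K (Sum.inr v)).toAddMonoidHom.comp (LCarrier.val (ideleBarD K)))
            (Z.1 (absGaloisRestrict K (v.adicCompletion K) s, absGaloisRestrict K (v.adicCompletion K) t))) →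
        -- archimedean hypothesis: every local projection class of `Z` at an infinite place vanishes
        (∀ (w : InfinitePlace K) (cW : contTwoCocycles (units (Place.Completion (Sum.inl w : Place K))).toTopRep),
          (∀ s t : absoluteGaloisGroup (Place.Completion (Sum.inl w : Place K)),
            cW.1 (s, t) = ((IdeleReadout.ideleProjection K (Sum.inl w)).toAddMonoidHom.comp (LCarrier.val (ideleBarD K)))
              (Z.1 (absGaloisRestrict K (Place.Completion (Sum.inl w : Place K)) s,
                absGaloisRestrict K (Place.Completion (Sum.inl w : Place K)) t))) →
          (haveI := absoluteGaloisGroup_compactSpace (Place.Completion (Sum.inl w : Place K));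
            twoCocycleClass (units (Place.Completion (Sum.inl w : Place K))).toTopRep cW) = 0) →
        (∃ Tf : Finset (HeightOneSpectrum (𝓞 K)), ∀ T : Finset (HeightOneSpectrum (𝓞 K)), Tf ⊆ T →
          ∑ v ∈ T, (haveI := charZero_adicCompletion v; haveI := absoluteGaloisGroup_compactSpace (v.adicCompletion K);
              Prop121vii.brauerInvariantEquiv (v.adicCompletion K)
                (twoCocycleClass (units (v.adicCompletion K)).toTopRep (cZ v))) = 0) →
        classBarInv K (((extOneEquiv ρ₀).symm (oneCocycleClass _ γ)).comp
          (boundary (presentationComplex_shortExact ρ₀) (classBarD K) h) (rfl : 1 + 1 = 2)) = 0) :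
    ∀ (W : WeierstrassCurve ℚ) [W.IsElliptic] (p M₀ : ℕ), p.Prime → p ≠ 2 → 1 ≤ M₀ →
      ∀ [NeZero (p ^ M₀)] [NeZero (p ^ M₀ * p ^ M₀)] [Finite (geomTorsion (W.baseChange K) ((p ^ M₀ : ℕ) : ℤ))]
        (e : geomTorsion (W.baseChange K) ((p ^ M₀ * p ^ M₀ : ℕ) : ℤ) →
          geomTorsion (W.baseChange K) ((p ^ M₀ * p ^ M₀ : ℕ) : ℤ) → AlgebraicClosure K)
        (hμ : ∀ S T, e S T ^ (p ^ M₀ * p ^ M₀) = 1)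
        (hadd₁ : ∀ S₁ S₂ T, e (S₁ + S₂) T = e S₁ T * e S₂ T)
        (hadd₂ : ∀ S T₁ T₂, e S (T₁ + T₂) = e S T₁ * e S T₂)
        (hgal : ∀ (σ : absoluteGaloisGroup K)
          (S T : geomTorsion (W.baseChange K) ((p ^ M₀ * p ^ M₀ : ℕ) : ℤ)), σ • e S T = e (σ • S) (σ • T)),
        (∀ T, e T T = 1) → (∀ T, (∀ S, e S T = 1) → T = 0) →
        ∀ f : contTwoCocycles ((W.baseChange K).torsionGaloisModule ((p ^ M₀ : ℕ) : ℤ)).toTopRep,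
          (∀ g : contOneCocycles ((W.baseChange K).torsionGaloisModule ((p ^ M₀ : ℕ) : ℤ)).toTopRep,
            (∀ v : Place K, locClass ((W.baseChange K).torsionGaloisModule ((p ^ M₀ : ℕ) : ℤ))
                (Place.Completion v)
                (resOne ((W.baseChange K).torsionGaloisModule ((p ^ M₀ : ℕ) : ℤ)) (Place.Completion v) g) = 0) →
            ∃ (C : PTChoice (W.baseChange K) (p ^ M₀) e hμ hadd₁ hadd₂ hgal f g) (S : Finset (Place K)),
              (∀ v ∉ S, C.localTerm (LocalInvariants.canonical K (p ^ M₀ * p ^ M₀)) v = 0) ∧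
                ∑ v ∈ S, C.localTerm (LocalInvariants.canonical K (p ^ M₀ * p ^ M₀)) v = 0) →
          ∀ h : (presentationComplex ((W.baseChange K).torsionGaloisModule ((p ^ M₀ : ℕ) : ℤ))).X₁ ⟶ classBarD K,
            shaTwoConnecting ((W.baseChange K).torsionGaloisModule ((p ^ M₀ : ℕ) : ℤ)) (p ^ M₀ * p ^ M₀)
                (FirstCaseData.mul_nsmul_geomTorsion_eq_zero (W := W.baseChange K) (m := p ^ M₀)) h =
              galoisCohomology.map (pairingDualIntertwining
                (ρ₁ := (W.baseChange K).torsionGaloisModule ((p ^ M₀ : ℕ) : ℤ))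
                (ρ₂ := (W.baseChange K).torsionGaloisModule ((p ^ M₀ : ℕ) : ℤ))
                (B := (descendHom (W.baseChange K) (p ^ M₀) (p ^ M₀) e hμ hadd₁ hadd₂).flip)
                (descendHom_flip_smul (W.baseChange K) (p ^ M₀) e hμ hadd₁ hadd₂ hgal)) 2
                (twoCocycleClass _ f) →
            ∀ y ∈ sha ((W.baseChange K).torsionGaloisModule ((p ^ M₀ : ℕ) : ℤ)),
              classBarInv K (((extOneEquiv ((W.baseChange K).torsionGaloisModule ((p ^ M₀ : ℕ) : ℤ))).symm y).comp
                (boundary (presentationComplex_shortExact ((W.baseChange K).torsionGaloisModule ((p ^ M₀ : ℕ) : ℤ)))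
                  (classBarD K) h) (rfl : 1 + 1 = 2)) = 0 := by
  intro W _ p M₀ hp hp2 hM₀ _ _ _ e hμ hadd₁ hadd₂ hgal halt hnd f hf h hh y hy
  haveI := absoluteGaloisGroup_compactSpace K
  -- the level: `p^{M₀}` odd, `H³(K, μ_{p^{2M₀}}) = 0`
  have hm : Odd (p ^ M₀) := (hp.odd_of_ne_two hp2).pow
  have hodd : Odd (p ^ M₀ * p ^ M₀) := hm.mul hm
  haveI : Fact p.Prime := ⟨hp⟩
  haveI : NeZero (p ^ (M₀ + M₀)) := ⟨pow_ne_zero _ hp.ne_zero⟩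
  have hH3 : ∀ z : galoisCohomology (mu K (p ^ M₀ * p ^ M₀)) 3, z = 0 := by
    rw [← pow_add]
    exact fun z => galoisCohomology_three_mu_eq_zero_of_ne_two K p (M₀ + M₀) hp2 z
  -- a cocycle `γ ∈ y`, locally trivial
  obtain ⟨γ, rfl⟩ := oneCocycleClass_surjective _ y
  have hγ := (oneCocycleClass_mem_sha_iff_locClass ((W.baseChange K).torsionGaloisModule ((p ^ M₀ : ℕ) : ℤ)) γ).1 hy
  -- the bridge sum package for THE idèle projections
  obtain ⟨c, ht, Z, S', h3, h4, h5, -, hb, hc⟩ :=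
    exists_bridge_sum_localInvariants_eq_zero (hgal := hgal) hm hH3 hf h hh hγ fun v => IdeleReadout.ideleProjection K v
  -- the local projection cocycles at the finite places
  choose cZ hcZ using fun v : HeightOneSpectrum (𝓞 K) =>
    exists_localProjectionCocycle Z (Sum.inr v) (IdeleReadout.ideleProjection K (Sum.inr v))
  -- the archimedean classes vanish: `m²`-torsion with `m²` odd, and `2 · H²(K_w, ·) = 0`
  have hinf : ∀ (w : InfinitePlace K) (cW : contTwoCocycles (units (Place.Completion (Sum.inl w : Place K))).toTopRep),
      (∀ s t : absoluteGaloisGroup (Place.Completion (Sum.inl w : Place K)),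
        cW.1 (s, t) = ((IdeleReadout.ideleProjection K (Sum.inl w)).toAddMonoidHom.comp (LCarrier.val (ideleBarD K)))
          (Z.1 (absGaloisRestrict K (Place.Completion (Sum.inl w : Place K)) s,
            absGaloisRestrict K (Place.Completion (Sum.inl w : Place K)) t))) →
      (haveI := absoluteGaloisGroup_compactSpace (Place.Completion (Sum.inl w : Place K));
        twoCocycleClass (units (Place.Completion (Sum.inl w : Place K))).toTopRep cW) = 0 := fun w cW hcW =>
    eq_zero_of_odd_nsmul_eq_zero_two_infinitePlace w _ hodd _ (hc (Sum.inl w) cW hcW)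
  -- the criterion: the finite-place invariant sums vanish over every `T ⊇ S′ ∩ {finite}` by (b)
  exact hS3c (p ^ M₀ * p ^ M₀) ((W.baseChange K).torsionGaloisModule ((p ^ M₀ : ℕ) : ℤ))
    (FirstCaseData.mul_nsmul_geomTorsion_eq_zero (W := W.baseChange K) (m := p ^ M₀)) h γ c ht Z h3 h4 h5 cZ hcZ hinf
    ⟨S'.toRight, fun T hT => hb T (fun v hv => hT (Finset.mem_toRight.2 hv)) cZ hcZ⟩

end Summit.BirchSwinnertonDyer.BirchSwinnertonDyer.Theorems.ShaTwoCochainTheta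

end
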